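import Literature.MathematicalPhysics.QuantumFieldTheory.Balaban1983to89.B8SockHFPRD
import Literature.MathematicalPhysics.QuantumFieldTheory.Balaban1983to89.B8SockHFP59BdryBeta
import Literature.MathematicalPhysics.QuantumFieldTheory.Balaban1983to89.B8SockHFPCubeMember
import Literature.MathematicalPhysics.QuantumFieldTheory.Balaban1983to89.B8LeafKnitZd3CubBdryBeta

/-!
# `Balaban1983to89.B8SockHFPRDBdryBeta` — [Balaban1985RegularSpaces] Prop. 5 p. 94 with Thm 4 p. 88: THE PROPOSITION-5 FIXED-POINT SOCKETS `SockHFP₀`∕`SockHFP`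
# FROM THE [4]-LETTERS SOCKET ON PRINT'S DOMAINS AND THE ALL-LEVELS β COLLAR SOCKET FAMILY — `B8SockHFPRD` §3–§4 (p467197) and `B8SockHFPCubeMemberRD` §1 re-run
# with the b9 socket `SockB9P3` (currency R-d, refuted at a finite region) REPLACED by dag-n06-b's `SockB9P3D4β` (p541339), on dag-n05-e's β body
# `B8SockHFP59BdryBeta.sockHFP_body_of_join_59_bdryβ` (p552062); and Proposition 5's two EXISTENCE sockets on the cube sub-family of (1.131) from cube letters,
# keyed on the β family they are asked with

statement-level skeleton of published theorems with citation tags; proofs where landed; nothing here is a claim about the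
Yang–Mills mass gap

PDF held: `paper:balaban1985-cmp99-regular-spaces-gauge-fixing` (journal page = PDF page + 74); p. 88 (Thm 4, (1.66)–(1.69)), p. 89, pp. 92–94 ((1.92)–(1.109),
Prop. 5), p. 86 ((1.59)), p. 82 ((1.31)), p. 99 ((1.131)).  [4] = [Balaban1985BackgroundPropagators] (Thm 3.1 p. 397, (3.25) p. 394, Thm 3.3 p. 399, (3.16) p. 393).

CITATION HEADER (lean-in-tree rule).  Cell `pub-ymgap` (HUMAN RULING D-0062, Track A), DAG node N05 = [B8], seat `pub-ymgap-dag-n05-d` (g9; R134 row s2), 2026-08-27.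
WHY THIS FILE.  The `Ω₀ = ℤᵈ` road of N05 (`Summits/…/BalabanUVNodesN05SubBHKnitUnivOfThm33P6Beta`, p566904) now supplies Proposition 6 on the record's cube family from
N06's Theorem 3.3 BY NAME (dag-n05-e's β letters), displaying Proposition 5's plain sockets `SockP5base ∕ SockP5 (∕ SockP5u)` at the CUBE sub-family of (1.131) as hypotheses.
Their in-tree road is `B8LeafModelZdOfHFP.sockP5base_of_sockHFP₀ ∕ sockP5_of_sockHFP` ← `SockHFP₀ ∕ SockHFP` ← [4]'s letters `SockLettersRD` + the b9 socket at every
truncation (this seat's `B8SockHFPRD.exists_threshold_sockHFP_pairRD`, p467197; cube member `B8SockHFPCubeMemberRD.sockHFP_pair_cubeMemberRD`) — but that b9 socket is the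
R-d `SockB9P3`, FALSE at a finite region (boundary pure-gauge mode: dag-n06-b p539131, `B8JunctionH59Vacuity`).  The repair of record is EDITION β (dag-lead RULING №189 (2);
dag-n06-b `B9SupplySockB9P3ZdBeta`: `SockB9P3D4β`, the averaging datum `|B₁|β` over the constraint bonds AND the level-0 crossing bonds, exterior-collar term `B_∂Φ₀`), and
dag-n05-e re-ran the Prop.-5 BODY in β (`B8SockHFP59BdryBeta.sockHFP_body_of_join_59_bdryβ`, p552062: the level-`m` ∃λ-body with Theorem 4's own two-member (1.59) clause
`H59Dβm`, the boundary-layer law `hlay`, `0 ≤ B_∂`, `4B_∂ ≤ (dL − 1)B₀`).  THIS FILE assembles the SOCKETS from that body (dag-lead g12 DEDUP-335 (1): «T4-prep is n05-d's»):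
* §1 ★ `sockHFP_of_sockLettersRD_bdryβ` — `B8SockHFPRD.sockHFP_of_sockLettersRD` VERBATIM with `SB9all : ∀ m ≤ k, SockB9P3 …` replaced by the all-levels β family
  `SB9β : ∀ m ≤ k, SockB9P3D4β L B₀ B_∂ c_{P9} η m Ω Λs Λb` + `hlay`, `hBbd`, `hBd`; the windows family reads `c_{B9} := c_{P9}`.  Proof: the letters at `m + 1`, the
  windows, and `H59Dβm` READ OFF `SB9β m` at the datum `(U₀, U₁ = U′^{u₁⁻¹}, A)` — `U₁` unitary (`mem_unitaryUnits_of_mgauge_eq`), `U₀ ∈ 𝔄_m` by restriction of levels,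
  `U₁·U₀`-regularity from `U′·U₀`'s by gauge covariance (`mulCfg_eq_gaugeAct_of_mgauge_eq`, `inAk_gaugeAct_iff`), the Landau condition of record, `α₂ := c⋆ ≤ c_{P9}` —
  exactly as dag-n05-e's `B8LeafKnitZd3CubBdryBeta.sockH59Dβ_of_allLevelsD4β` reads Theorem 4's socket; then the β body.
* §2 `exists_threshold_sockHFP_pair_bdryβ` — ONE threshold `c_F = min(c_P, c_L)` for the whole family (`B8SockHFPWindows.hfpWindows_of_guard` at `c_{B9} := c_{P9}`; the base
  `SockHFP₀` by the unchanged `B8SockHFPRD.sockHFP₀_of_sockLettersRD` — it reads no (1.59) clause); `sockHFP_pair_cubeMember_bdryβ` — at the concrete cube member the six laws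
  (`B8CubeMemberZd`, `B8SockHFPCubeMember`) AND `hlay` (dag-n05-e `bdryLayer_cubeMember`) are theorems.
* §3 ★★ `sp5_pair_cubeSubfamily_of_lettersRD_bdryβ` — PROPOSITION 5's TWO EXISTENCE SOCKETS ON THE CUBE SUB-FAMILY FROM CUBE LETTERS, KEYED ON THE β FAMILY: from
  `SockLettersRD L B_G B_R B₀′_H B₂′ c_L` at every cube member, for EVERY `B₀ > 0`, `B_∂ ≥ 0`, `c_{P9} > 0` and every all-levels `SockB9P3D4β L B₀ B_∂ c_{P9}` family on the cube
  sub-family, THERE ARE `B₀′ᶜ := max{1, 3(2dL²)B_G B_R}` and `c_P > 0` with `SockP5base ∕ SockP5 L B₀ˢ B₀′ᶜ c_P` at every cube member, `B₀ˢ = max (max 1 B₀) (4B_∂∕(dL−1))`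
  (dag-n05-e's enlarged constant: `B₀ ≤ B₀ˢ` by `sockB9P3D4β_mono_B₀`, `4B_∂ ≤ (dL−1)B₀ˢ` identically); adapters `B8LeafModelZdOfHFP.windows4`, `sockP5base_of_sockHFP₀`,
  `sockP5_of_sockHFP`.  This is VERBATIM the hypothesis `hSP5C` of the existence-only knit `…KnitUnivOfThm33P6Beta3` (this seat), which it therefore DISCHARGES from cube letters.

HONEST SCOPE.  Plumbing by name over landed modules (one verbatim β re-run + three compositions); nothing of Proposition 5's contraction (the JOIN), of [4]'s letters
(hypotheses: `SockLettersRD`), of [4] Thm 3.3 (the β family is a hypothesis; dag-n06-b supplies it from `B9.Thm33Printed` + member-local binders, A6-witnessed at truncation 0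
by `B9SupplySockB9P3ZdBeta.Witness.sockB9P3D4β_at_nonvacuous_cube_zero`) or of Sect. E is proved here beyond composition.  A6: `SockLettersRD` at a cube member has NO in-tree
provider or witness (the certified obstructions W8∕W8′ concern the withdrawn total-law sockets, not this one); nothing is claimed about its satisfiability.  Count-neutral;
N05 NOT discharged; `T_η ↦ ℤᵈ`; one finite `T⁴` programme at fixed `ε`, Bałaban as printed — nothing continuum ∕ ℝ⁴ ∕ OS ∕ mass-gap ∕ Clay.  No `sorry`, no `def`, no
`instance`, no `notation`.  Unit `pub-ymgap-dag-n05-d` (g9), 2026-08-27.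
-/


noncomputable section

open NormedSpace
open scoped BigOperators

namespace Literature.MathematicalPhysics.QuantumFieldTheory.Balaban1983to89.B8SockHFPRDBdryBeta

open Complex (I)
open MatrixLog B7Prop1Explicit B7Prop2Explicit B7Prop1Local B7Eq92Concrete
open B7Prop2Explicit (C0 c2')
open B7Prop3Flat (c3)
open B7Prop10General (C6 C4G)
open B7Prop9Flat (C5')
open B7Eq78Linearization (conjR zdBlocking QprimeIter)
open B8Ineq132 (covDerivFwd covDeriv InAk BondTouches)
open B8Eq119TwistedAxial (Restr129 InAx bgT)
open B8Eq184Proof (gaugeExp cfgExp)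
open B8Eq182Proof (gAd)
open B8Eq188Proof (frakF3)
open B8Lemma1NonAbelian (mulCfg)
open B8Eq140Level (SideTouches sideTouches_mono)
open B8Eq146AExpansion (iEta expCfg)
open B8Ineq130 (tlo thi)
open B8Thm2LogB (blockTop)
open B8Eq138LandauZd (IsLandau138W covDivB covLap QT)
open B8Ineq125Concrete (C2p)
open B8Eq1117Concrete (XSpace)
open B7Prop4GeneralLevels (linCovIter)
open B8Eq155JBound (Jcur wsup)
open B8ScaledSupNorm (bondNorm msup Bdd)
open B8Prop3GaugeFixedKLevel (mem_unitaryUnits_of_mgauge_eq mulCfg_eq_gaugeAct_of_mgauge_eq)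
open B8Prop5ContractionKLevel (Bd2 Mc Kc)
open B8LambdaSpaceKLevel (wt)
open B8LeafModelZd (ZdIdx SockP5base SockP5)
open B8LeafModelZdOfHFP (SockHFP₀ SockHFP windows4 sockP5base_of_sockHFP₀ sockP5_of_sockHFP)
open B8SockLettersRD (SockLettersRD)
open B8SockHFPRD (sockHFP₀_of_sockLettersRD)
open B8SockHFPWindows (hfpWindows_of_guard)
open B8SockHFP59BdryBeta (sockHFP_body_of_join_59_bdryβ)
open B8Eq131CubesAdmissible (cubeFam)
open B8CubeMemberZd (cubeLamS cubeLamB hΩ_cubeFam hbox_cubeLamB hclass_cubeLamB)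
open B8SockHFPCubeMember (htw_cubeLamS h8lt_cubeLamS h8top_cubeLamS)
open B8LeafKnitZd3CubBdryBeta (bdryLayer_cubeMember sockB9P3D4β_mono_B₀)
open B9SupplySockB9P3ZdBeta (CrossB SockB9P3D4β)
open QuantumLattice (blockSites)

-- `Site` alone could resolve to the torus sites of `Setup.lean`; re-export the `ℤ^d` sites of `B7Prop1Explicit`.
export B7Prop1Explicit (Site)

variable {d : ℕ}

/-! ## §1 `SockHFP` at ONE member from the letters socket ON PRINT'S DOMAINS, the boundary-layer law and the all-levels β collar family -/

section OneMember

variable {𝔸 : Type*} [CStarAlgebra 𝔸] [Nontrivial 𝔸]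
variable {L : ℕ} {η : ℝ} {k : ℕ} {Ω : ℕ → Set (Site d)} {Λs : ℕ → ℕ → Set (Site d)} {Λb : ℕ → ℕ → Set (Site d × Fin d)}
  {B₀ B₀' B₀'H B₂' BG BR cL cP : ℝ}

/-- ★ **`SockHFP` AT ONE MEMBER FROM THE [4]-LETTERS SOCKET ON PRINT'S DOMAINS AND THE ALL-LEVELS β COLLAR SOCKET FAMILY** — `B8SockHFPRD.sockHFP_of_sockLettersRD`
(p467197) VERBATIM except: the R-d b9 socket `SB9all : ∀ m ≤ k, SockB9P3 …` (refuted at a finite region) is REPLACED by dag-n06-b's all-levels four-line β collar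
socket family `SB9β : ∀ m ≤ k, SockB9P3D4β L B₀ B_∂ c_{P9} η m Ω Λs Λb` (p541339), the member's boundary-layer law `hlay` and the exterior-collar constant with its
absorption window `0 ≤ B_∂`, `4B_∂ ≤ (dL − 1)B₀` are displayed, and the windows family reads `c_{B9} := c_{P9}`.  The member's `ZdIdx` laws, towers at every
truncation, index law №8, the letters `SockLettersRD` at `(m + 1, U₀)`, and the windows in the shape of `B8SockHFPWindows.hfpWindows_of_guard` are as there.  Proof:
dag-n05-e's β body `B8SockHFP59BdryBeta.sockHFP_body_of_join_59_bdryβ` (p552062), its two-member (1.59) clause `H59Dβm` READ OFF `SB9β m` at the datum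
`(U₀, U₁ = U′^{u₁⁻¹}, A)` with `α₂ := c⋆ = 5dLB₀(α₀ + α₁) ≤ c_{P9}` (the recipe of dag-n05-e's `sockH59Dβ_of_allLevelsD4β`).
[cite: Balaban1985RegularSpaces, Prop. 5 (1.106)–(1.109) p.94, Thm 4 p.88, (1.67)–(1.69) p.88, (1.59) p.86, (1.31) p.82, p.89; Balaban1985BackgroundPropagators, Thm 3.1 p.397, (3.25) p.394, Thm 3.3 p.399] -/
theorem sockHFP_of_sockLettersRD_bdryβ (hd2 : 2 ≤ d) (hL : 2 ≤ L) (hη : 0 < η) (hΩ : ∀ j, Ω (j + 1) ⊆ Ω j)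
    (hbox : ∀ m, m ≤ k → ∀ j, j ≤ m → ∀ c ∈ Λb m j, ∀ x, InBox (loK L j c.1) (bondHiK L j c.1 c.2) x → x ∈ Ω j)
    (hclass : ∀ m, m ≤ k → ∀ j, j ≤ m → ∀ c ∈ Λb m j,
      (c.1 ∈ Λs m j ∧ c.1 + e c.2 ∈ Λs m j) ∨
      (∃ j', j = j' + 1 ∧ (∀ x, (L : ℤ) • c.1 ≤ x → x ≤ (L : ℤ) • c.1 + blockTop L → x ∈ Λs m j') ∧ c.1 + e c.2 ∈ Λs m j) ∨
      (∃ j', j = j' + 1 ∧ c.1 ∈ Λs m j ∧ (∀ x, (L : ℤ) • (c.1 + e c.2) ≤ x → x ≤ (L : ℤ) • (c.1 + e c.2) + blockTop L → x ∈ Λs m j')))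
    (htw : ∀ m, m ≤ k → ∀ j, j ≤ m → ∀ y ∈ Λs m j, ∀ x, InBox (tlo L y j) (thi L y j) x → x ∈ Ω j)
    (h8lt : ∀ m, m < k → ∀ j, j < m → Λs m j = Λs (m + 1) j)
    (h8top : ∀ m, m < k → ∀ x, x ∈ Λs m m ↔ x ∈ Λs (m + 1) m ∨ ∃ y ∈ Λs (m + 1) (m + 1), x ∈ blockSites L y)
    (hB₀ : 0 < B₀) (hB₀' : 0 < B₀') (hB₀'H : 0 < B₀'H) (hB₂' : 0 ≤ B₂') (hBG : 0 ≤ BG) (hBR : 0 ≤ BR)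
    (SLet : SockLettersRD (𝔸 := 𝔸) L BG BR B₀'H B₂' cL η k Ω Λs)
    -- the boundary-layer law of the member's region (print's (1.29)₀ territory; a theorem at the cube members, `bdryLayer_cubeMember`)
    (hlay : ∀ m, 1 ≤ m → m ≤ k → ∀ y z : Site d, y ∈ Ω 0 → z ∉ Ω 0 → (∀ i, y i - 1 ≤ z i ∧ z i ≤ y i + 1) → y ∈ Λs m 0)
    -- the exterior-collar constant, its absorption window, and THE ALL-LEVELS FOUR-LINE β COLLAR SOCKET FAMILY at the member (in place of the R-d b9 socket)
    {Bbd cP9 : ℝ} (hBbd : 0 ≤ Bbd) (hBd : 4 * Bbd ≤ ((d : ℝ) * L - 1) * B₀)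
    (SB9β : ∀ m, m ≤ k → SockB9P3D4β (𝔸 := 𝔸) L B₀ Bbd cP9 η m Ω Λs Λb) (hcPL : cP ≤ cL)
    (hwin : ∀ α₀ α₁ : ℝ, 0 < α₀ → 0 < α₁ → α₀ + α₁ ≤ cP →
      ∀ cs α₄ cB cDA hE hE₂ lE lE₂ : ℝ, cs = 5 * (d : ℝ) * L * B₀ * (α₀ + α₁) → α₄ = 8 * B₀' * (5 * (d : ℝ) * L * B₀) * (α₀ + α₁) →
      cB = L * cs → cDA = 2 * (d : ℝ) * (L : ℝ) ^ 2 * cs →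
      hE = B₀'H * (C2p d * (40 * d * cB + α₄) * α₄) → hE₂ = B₂' * (C2p d * (40 * d * cB + α₄) * α₄) →
      lE = B₀'H * (4 * C2p d * (40 * d * cB + 2 * α₄)) → lE₂ = B₂' * (4 * C2p d * (40 * d * cB + 2 * α₄)) →
      36 * d * B₀ * cs ≤ 1 / 2 ∧
      8 * (131072 * ((d : ℝ) + 1) ^ 2) * Real.exp (4 * (800 * ((d : ℝ) + 1) ^ 2 * ((d : ℝ) + 4)) * α₀) ≤ 16 * (131072 * ((d : ℝ) + 1) ^ 2) ∧
      2 * cs ^ 2 + 20 * d * α₀ * cs + 2 * (16 * (131072 * ((d : ℝ) + 1) ^ 2)) * cs ^ 2 ≤ α₀ + α₁ ∧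
      (d : ℝ) * L * α₁ ≤ 1 / 8 ∧
      α₀ ≤ cP9 ∧ cs ≤ cP9 ∧
      C0 d * α₀ ≤ 1 / 3 ∧ 4 * α₀ ≤ c2' d L ∧
      Real.exp (4 * (800 * ((d : ℝ) + 1) ^ 2 * ((d : ℝ) + 4)) * α₀) * (1 + 8 * (131072 * ((d : ℝ) + 1) ^ 2) * cB) ≤ 2 ∧
      2 * cB ≤ c3 d L ∧ 2048 * (d : ℝ) * cB ≤ 1 ∧ 40 * d * cB ≤ 1 / 200 ∧
      200 * C6 d * (2 * α₄) ≤ 1 ∧ 12000 * ((d : ℝ) + 1) * L * (2 * α₄) ≤ 1 ∧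
      C4G d L * (α₀ + 40 * d * cB + 4 * (2 * α₄)) ≤ 1 ∧
      1024 * ((d : ℝ) + 1) * ((d : ℝ) + 4) * L ^ 2 * α₀ ≤ 1 ∧ 32 * ((d : ℝ) + 1) ^ 2 * C6 d * L ^ 2 * α₀ ≤ 1 ∧
      16 * d * C5' d * C6 d * (L : ℝ) ^ 2 * α₀ ≤ 1 ∧ 8 * d * C6 d * L * α₀ ≤ 1 ∧
      40 * d * cB + α₄ ≤ 1 / (4 * B₀'H * (2 * C2p d)) ∧ 2 * C6 d * (40 * d * cB + 4 * α₄) ≤ 1 / 8 ∧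
      cB ≤ 1 / 13 ∧ α₄ / 4 + hE ≤ 1 / 24 ∧ α₄ / 4 + hE ≤ 1 / 140 ∧ 10 * (α₄ / 4 + hE) * BR ≤ 1 / 2 ∧
      BG * Mc d BR (α₄ / 4 + hE) cB hE₂ cDA ≤ α₄ / 4 ∧
      BG * Kc d BR (α₄ / 4 + hE) cB hE₂ cDA lE₂ (1 + lE) (1 + lE) ≤ 1 / 2) :
    SockHFP (𝔸 := 𝔸) L B₀ B₀' cP η k Ω Λs := by
  intro α₀ α₁ hα₀ hα₁ hs U₀ U' hU₀ hU' h33 h34 hAx h135 h66 m hm1 hmk u₁ U₁ A hu₁ hu₁S hW h129 hLan hdat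
  -- the windows at this (α₀, α₁)
  obtain ⟨hside, hC₂, h61, hsmall₁, hα₀9, hcs9, hα3, hα4, hsmall, hc₃, hsc, hα₃', hs₁, hs₂, hs₃, hs₄, hs₅, hs₆, hs₇, hsm, hprod8, hcA', ha₁',
    hb₁', hθ, h103, h106⟩ := hwin α₀ α₁ hα₀ hα₁ hs _ _ _ _ _ _ _ _ rfl rfl rfl rfl rfl rfl rfl rfl
  -- the letters at the truncation `m + 1`
  have hα₀L : α₀ ≤ cL := by linarith
  obtain ⟨g, Δ, q, qs, Aw, c, H', g_rightΩ, c_range, hΔ, hqs, hq, hH0, hH1, hH2, hHsupp, hHequiv, hQH, hG, hGsupp, hGreal, hRbd, hRreal⟩ :=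
    SLet α₀ hα₀ hα₀L U₀ hU₀ h33 (m + 1) (by omega) hmk
  have hcs0 : 0 < 5 * (d : ℝ) * L * B₀ * (α₀ + α₁) := by
    have : 0 < α₀ + α₁ := by linarith
    positivity
  have hcDAlo : (d : ℝ) * (L : ℝ) ^ 2 * (5 * (d : ℝ) * L * B₀ * (α₀ + α₁)) ≤ 2 * (d : ℝ) * (L : ℝ) ^ 2 * (5 * (d : ℝ) * L * B₀ * (α₀ + α₁)) := by
    have h := mul_nonneg (by positivity : (0 : ℝ) ≤ (d : ℝ) * (L : ℝ) ^ 2) hcs0.le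
    linarith only [h]
  -- Theorem 4's own two-member (1.59) clause in edition β for the level-`m` datum, READ OFF the β collar socket at truncation `m` (as n05-e's
  -- `sockH59Dβ_of_allLevelsD4β` reads Theorem 4's): the datum `(U₀, U₁ = U′^{u₁⁻¹}, A′)` is a datum of `SockB9P3D4β … m …` at `(α₀, α₂ := c⋆)`
  have H59Dβm : ∀ A' : Site d → Fin d → 𝔸, (∀ y τ, IsSelfAdjoint (A' y τ)) →
      (∀ j, j ≤ m → ∀ (y : Site d) (τ : Fin d), SideTouches (Ω j) y τ →
        U₁ y τ = cfgExp η A' y τ ∧ ‖A' y τ‖ ≤ 5 * (d : ℝ) * L * B₀ * (α₀ + α₁) * ((L : ℝ) ^ j * η)⁻¹) →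
      (∀ (y : Site d) (τ : Fin d), (∀ j, j ≤ m → ¬ SideTouches (Ω j) y τ) → A' y τ = 0) →
      msup L m η (-(1 : ℝ)) (fun j (b : Site d × Fin d) => SideTouches (Ω j) b.1 b.2) (fun b => A' b.1 b.2)
          ≤ B₀ * (bondNorm L m η (-(3 : ℝ)) Ω (fun x μ => Jcur η U₀ A' μ x)
            + wsup 1 (fun p : {p : ℕ × (Site d × Fin d) // p.1 ≤ m ∧ (p.2 ∈ Λb m p.1 ∨ (p.1 = 0 ∧ CrossB (Ω 0) p.2))} =>
                linCovIter L U₀ (iEta η A') p.1.1 p.1.2.1 p.1.2.2))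
            + Bbd * msup L m η (-(1 : ℝ)) (fun j (b : Site d × Fin d) => j = 0 ∧ SideTouches (Ω 0) b.1 b.2 ∧ ¬ BondTouches (Ω 0) b.1 b.2)
                (fun b => A' b.1 b.2) ∧
        msup L m η (-(2 : ℝ)) (fun j (t : Fin d × Fin d × Site d) => SideTouches (Ω j) t.2.2 t.2.1)
            (fun t => covDerivFwd η U₀ t.1 (fun z => A' z t.2.1) t.2.2)
          ≤ B₀ * (bondNorm L m η (-(3 : ℝ)) Ω (fun x μ => Jcur η U₀ A' μ x)
            + wsup 1 (fun p : {p : ℕ × (Site d × Fin d) // p.1 ≤ m ∧ (p.2 ∈ Λb m p.1 ∨ (p.1 = 0 ∧ CrossB (Ω 0) p.2))} =>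
                linCovIter L U₀ (iEta η A') p.1.1 p.1.2.1 p.1.2.2))
            + Bbd * msup L m η (-(1 : ℝ)) (fun j (b : Site d × Fin d) => j = 0 ∧ SideTouches (Ω 0) b.1 b.2 ∧ ¬ BondTouches (Ω 0) b.1 b.2)
                (fun b => A' b.1 b.2) := by
    intro A' hsa hUA hA0
    have hWu : ∀ x κ, U₁ x κ ∈ unitaryUnits 𝔸 := mem_unitaryUnits_of_mgauge_eq hU₀ hU' hu₁ hW
    have h33m : InAk L m η α₀ Ω U₀ := fun j hj => h33 j (hj.trans hmk.le)
    have h34m : InAk L m η α₀ Ω (mulCfg U₁ U₀) := by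
      have h1 : InAk L m η α₀ Ω (mulCfg U' U₀) := fun j hj => h34 j (hj.trans hmk.le)
      have hui : ∀ x, u₁⁻¹ x ∈ U1 𝔸 := fun x => unitaryUnits_le_U1 ((unitaryUnits 𝔸).inv_mem (hu₁ x))
      rw [mulCfg_eq_gaugeAct_of_mgauge_eq hW]
      exact (B8Ineq132.inAk_gaugeAct_iff L m η α₀ Ω hui _).2 h1
    obtain ⟨ha, hg, -, -⟩ := SB9β m hmk.le α₀ (5 * (d : ℝ) * L * B₀ * (α₀ + α₁)) hα₀ hα₀9 hcs0 hcs9 U₀ U₁ hU₀ hWu h33m h34m hLan A' hsa hUA hA0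
    exact ⟨ha, hg⟩
  exact sockHFP_body_of_join_59_bdryβ hd2 hL hη hΩ hbox hclass hm1 hmk (htw (m + 1) hmk) (h8lt m hmk) (h8top m hmk) hα₀ hα₁ hB₀ hB₀' rfl rfl hU₀ hU'
    h33 h34 hAx h135 h66 hlay hBbd hBd hu₁ hu₁S hW h129 hLan hdat H59Dβm hside hC₂ h61 hsmall₁ g Δ q qs Aw c g_rightΩ c_range hΔ hqs hq H'
    hB₀'H hB₂' hBG hBR hH0 hH1 hH2 hHsupp hHequiv hQH hG hGsupp hGreal hRbd hRreal le_rfl le_rfl hcDAlo hα3 hα4 hsmall hc₃ hsc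
    hα₃' hs₁ hs₂ hs₃ hs₄ hs₅ hs₆ hs₇ hsm hprod8 rfl rfl rfl rfl hcA' ha₁' hb₁' hθ h103 h106

end OneMember

/-! ## §2 ONE threshold for the whole family in edition β -/

section Threshold

variable {𝔸 : Type*} [CStarAlgebra 𝔸] [Nontrivial 𝔸]

/-- **THE PROPOSITION-5 SOCKETS FROM THE [4]-LETTERS SOCKET ON PRINT'S DOMAINS AND THE β COLLAR FAMILY, BELOW ONE THRESHOLD** — `B8SockHFPRD.exists_threshold_sockHFP_pairRD`
in edition β: for `d, L ≥ 2`, `B₀, B₀′ > 0` with `2 ≤ 5dLB₀`, [4]-letters constants `B₀′_H > 0`, `B₂′, B_G, B_R ≥ 0` with threshold `c_L > 0`, the β family's threshold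
`c_{P9} > 0`, the free-constant condition `3·(2dL²)·B_G·B_R ≤ B₀′` and the exterior-collar data `0 ≤ B_∂`, `4B_∂ ≤ (dL − 1)B₀`, there is `c_F > 0` such that AT EVERY
member (`η > 0`, `k ≥ 1`, antitone `Ω`, `Λs`, `Λb` with the `ZdIdx` laws, towers at every truncation, index law №8, the boundary-layer law) the letters socket
`SockLettersRD … c_L …` and the all-levels β family `∀ m ≤ k, SockB9P3D4β L B₀ B_∂ c_{P9} …` give `SockHFP₀ L B₀ B₀′ c_F …` AND `SockHFP L B₀ B₀′ c_F …`
(`c_F = min(c_P, c_L)`; the base socket reads no (1.59) clause: `B8SockHFPRD.sockHFP₀_of_sockLettersRD` unchanged).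
[cite: Balaban1985RegularSpaces, Prop. 5 (1.106)–(1.109) p.94, Thm 4 p.88 («there exists a constant c₁»), (1.102)–(1.103) p.93, (1.59) p.86, p.89] -/
theorem exists_threshold_sockHFP_pair_bdryβ (hd2 : 2 ≤ d) {L : ℕ} (hL : 2 ≤ L) {B₀ B₀' B₀'H B₂' BG BR Bbd cP9 cL : ℝ} (hB₀ : 0 < B₀) (hB₀' : 0 < B₀')
    (hB : 2 ≤ 5 * (d : ℝ) * L * B₀) (hB₀'H : 0 < B₀'H) (hB₂' : 0 ≤ B₂') (hBG : 0 ≤ BG) (hBR : 0 ≤ BR) (hcP9 : 0 < cP9) (hcL : 0 < cL)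
    (hfree : 3 * (2 * (d : ℝ) * (L : ℝ) ^ 2) * BG * BR ≤ B₀') (hBbd : 0 ≤ Bbd) (hBd : 4 * Bbd ≤ ((d : ℝ) * L - 1) * B₀) :
    ∃ cF : ℝ, 0 < cF ∧ ∀ {η : ℝ}, 0 < η → ∀ {k : ℕ}, 1 ≤ k → ∀ {Ω : ℕ → Set (Site d)}, (∀ j, Ω (j + 1) ⊆ Ω j) →
      ∀ {Λs : ℕ → ℕ → Set (Site d)} {Λb : ℕ → ℕ → Set (Site d × Fin d)},
      (∀ m, m ≤ k → ∀ j, j ≤ m → ∀ c ∈ Λb m j, ∀ x, InBox (loK L j c.1) (bondHiK L j c.1 c.2) x → x ∈ Ω j) →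
      (∀ m, m ≤ k → ∀ j, j ≤ m → ∀ c ∈ Λb m j,
        (c.1 ∈ Λs m j ∧ c.1 + e c.2 ∈ Λs m j) ∨
        (∃ j', j = j' + 1 ∧ (∀ x, (L : ℤ) • c.1 ≤ x → x ≤ (L : ℤ) • c.1 + blockTop L → x ∈ Λs m j') ∧ c.1 + e c.2 ∈ Λs m j) ∨
        (∃ j', j = j' + 1 ∧ c.1 ∈ Λs m j ∧ (∀ x, (L : ℤ) • (c.1 + e c.2) ≤ x → x ≤ (L : ℤ) • (c.1 + e c.2) + blockTop L → x ∈ Λs m j'))) →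
      (∀ m, m ≤ k → ∀ j, j ≤ m → ∀ y ∈ Λs m j, ∀ x, InBox (tlo L y j) (thi L y j) x → x ∈ Ω j) →
      (∀ m, m < k → ∀ j, j < m → Λs m j = Λs (m + 1) j) →
      (∀ m, m < k → ∀ x, x ∈ Λs m m ↔ x ∈ Λs (m + 1) m ∨ ∃ y ∈ Λs (m + 1) (m + 1), x ∈ blockSites L y) →
      (∀ m, 1 ≤ m → m ≤ k → ∀ y z : Site d, y ∈ Ω 0 → z ∉ Ω 0 → (∀ i, y i - 1 ≤ z i ∧ z i ≤ y i + 1) → y ∈ Λs m 0) →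
      SockLettersRD (𝔸 := 𝔸) L BG BR B₀'H B₂' cL η k Ω Λs → (∀ m, m ≤ k → SockB9P3D4β (𝔸 := 𝔸) L B₀ Bbd cP9 η m Ω Λs Λb) →
        SockHFP₀ (𝔸 := 𝔸) L B₀ B₀' cF η k Ω Λs ∧ SockHFP (𝔸 := 𝔸) L B₀ B₀' cF η k Ω Λs := by
  have hd1 : 1 ≤ d := le_trans (by norm_num) hd2
  have hL1 : 1 ≤ L := le_trans (by norm_num) hL
  obtain ⟨cP, hcP, hwin⟩ := hfpWindows_of_guard hd1 hL1 hB₀ hB₀' hB hB₀'H hB₂' hBG hBR hcP9 hfree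
  refine ⟨min cP cL, lt_min hcP hcL, ?_⟩
  intro η hη k hk Ω hΩ Λs Λb hbox hclass htw h8lt h8top hlay SLet SB9β
  have hwin' : ∀ α₀ α₁ : ℝ, 0 < α₀ → 0 < α₁ → α₀ + α₁ ≤ min cP cL → _ :=
    fun α₀ α₁ hα₀ hα₁ hs => hwin α₀ α₁ hα₀ hα₁ (hs.trans (min_le_left _ _))
  exact ⟨sockHFP₀_of_sockLettersRD hd2 hL hη hk hΩ htw hB₀ hB₀' hB₀'H hB₂' hBG hBR SLet (min_le_right _ _) hwin',
    sockHFP_of_sockLettersRD_bdryβ hd2 hL hη hΩ hbox hclass htw h8lt h8top hB₀ hB₀' hB₀'H hB₂' hBG hBR SLet hlay hBbd hBd SB9β (min_le_right _ _) hwin'⟩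

/-- **`SockHFP₀` AND `SockHFP` AT THE CONCRETE CUBE MEMBER `{□_j}` OF (1.131) FROM `SockLettersRD` + THE β COLLAR FAMILY ALONE** — `exists_threshold_sockHFP_pair_bdryβ` with
the six member laws (`B8CubeMemberZd.hΩ_cubeFam ∕ hbox_cubeLamB ∕ hclass_cubeLamB`, `B8SockHFPCubeMember.htw_cubeLamS ∕ h8lt_cubeLamS ∕ h8top_cubeLamS`) AND the
boundary-layer law (dag-n05-e `B8LeafKnitZd3CubBdryBeta.bdryLayer_cubeMember`) DISCHARGED for `(Ω, Λs, Λb) := (cubeFam false, cubeLamS, cubeLamB) L a M ρ k`, `L ≤ ρ`,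
`k ≥ 1` — the β image of `B8SockHFPCubeMemberRD.sockHFP_pair_cubeMemberRD`.
[cite: Balaban1985RegularSpaces, Prop. 5 (1.106)–(1.108) p.94, (1.68) p.88, (1.131) p.99, (1.29) p.81; Balaban1985BackgroundPropagators, Thm 3.1 p.397, Thm 3.3 p.399] -/
theorem sockHFP_pair_cubeMember_bdryβ (hd2 : 2 ≤ d) {L : ℕ} (hL : 2 ≤ L) {B₀ B₀' B₀'H B₂' BG BR Bbd cP9 cL : ℝ} (hB₀ : 0 < B₀)
    (hB₀' : 0 < B₀') (hB : 2 ≤ 5 * (d : ℝ) * L * B₀) (hB₀'H : 0 < B₀'H) (hB₂' : 0 ≤ B₂') (hBG : 0 ≤ BG) (hBR : 0 ≤ BR)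
    (hcP9 : 0 < cP9) (hcL : 0 < cL) (hfree : 3 * (2 * (d : ℝ) * (L : ℝ) ^ 2) * BG * BR ≤ B₀') (hBbd : 0 ≤ Bbd) (hBd : 4 * Bbd ≤ ((d : ℝ) * L - 1) * B₀) :
    ∃ cF : ℝ, 0 < cF ∧ ∀ {η : ℝ}, 0 < η → ∀ {k : ℕ}, 1 ≤ k → ∀ (a : Site d) (M : ℕ) {ρ : ℕ}, L ≤ ρ →
      SockLettersRD (𝔸 := 𝔸) L BG BR B₀'H B₂' cL η k (cubeFam false L a M ρ k) (cubeLamS L a M ρ k) →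
      (∀ m, m ≤ k → SockB9P3D4β (𝔸 := 𝔸) L B₀ Bbd cP9 η m (cubeFam false L a M ρ k) (cubeLamS L a M ρ k) (cubeLamB L a M ρ k)) →
        SockHFP₀ (𝔸 := 𝔸) L B₀ B₀' cF η k (cubeFam false L a M ρ k) (cubeLamS L a M ρ k) ∧
        SockHFP (𝔸 := 𝔸) L B₀ B₀' cF η k (cubeFam false L a M ρ k) (cubeLamS L a M ρ k) := by
  have hL1 : 1 ≤ L := le_trans (by norm_num) hL
  obtain ⟨cF, hcF, H⟩ := exists_threshold_sockHFP_pair_bdryβ (𝔸 := 𝔸) hd2 hL hB₀ hB₀' hB hB₀'H hB₂' hBG hBR hcP9 hcL hfree hBbd hBd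
  refine ⟨cF, hcF, ?_⟩
  intro η hη k hk a M ρ hρL SLet SB9β
  exact H hη hk (hΩ_cubeFam hL1 a M hρL k) (hbox_cubeLamB L a M ρ k) (hclass_cubeLamB L a M ρ k) (htw_cubeLamS hL1 a M ρ k)
    (h8lt_cubeLamS L a M ρ k) (h8top_cubeLamS hL1 a M ρ k) (bdryLayer_cubeMember hL a M ρ k hρL hk) SLet SB9β

end Threshold

/-! ## §3 Proposition 5's two EXISTENCE sockets on the cube sub-family of (1.131) from cube letters, KEYED ON THE β FAMILY -/

section CubeSubfamily

variable {𝔸 : Type} [CStarAlgebra 𝔸] [Nontrivial 𝔸]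

/-- ★★ **PROPOSITION 5's TWO EXISTENCE SOCKETS ON THE CUBE SUB-FAMILY OF (1.131) FROM CUBE LETTERS, KEYED ON THE β FAMILY THEY ARE ASKED WITH** — from [4]'s letters
`SockLettersRD L B_G B_R B₀′_H B₂′ c_L` at EVERY member of the cube sub-family (`0 < B₀′_H`, `0 ≤ B₂′, B_G, B_R`, `0 < c_L`): for every `B₀ > 0`, `B_∂ ≥ 0`, `c_{P9} > 0`
and every all-levels β collar family `∀ j m, m ≤ k_j → SockB9P3D4β L B₀ B_∂ c_{P9} …` on the cube sub-family, THERE EXIST `B₀′ᶜ > 0` (`:= max{1, 3(2dL²)B_G B_R}`,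
absorbing the free-constant condition) and `c_P > 0` with `SockP5base L B₀ˢ B₀′ᶜ c_P` and `SockP5 L B₀ˢ B₀′ᶜ c_P` at every cube member, at dag-n05-e's ENLARGED constant
`B₀ˢ = max (max 1 B₀) (4B_∂∕(dL − 1))` (`B₀ ≤ B₀ˢ` — the family is moved there by `sockB9P3D4β_mono_B₀`; `2 ≤ 5dLB₀ˢ` and `4B_∂ ≤ (dL − 1)B₀ˢ` hold identically).
Proof: `sockHFP_pair_cubeMember_bdryβ`'s family form + `B8LeafModelZdOfHFP.windows4 ∕ sockP5base_of_sockHFP₀ ∕ sockP5_of_sockHFP` below `min(c_F, c₁)`.  VERBATIM the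
hypothesis `hSP5C` of this seat's existence-only knit `BalabanUVNodesN05SubBHKnitUnivOfThm33P6Beta3` — discharged from cube letters.  Proposition 5's UNIQUENESS socket is
not produced (print's Proposition 6 needs none).
[cite: Balaban1985RegularSpaces, Prop. 5 (1.106)–(1.108) p.94, Thm 4 p.88, p.89 («B₁ not too small»), (1.59)–(1.62) pp.86–87, (1.131) p.99; Balaban1985BackgroundPropagators, Thm 3.1 p.397, Thm 3.3 p.399] -/
theorem sp5_pair_cubeSubfamily_of_lettersRD_bdryβ (hd2 : 2 ≤ d) {L : ℕ} (hL : 2 ≤ L) {B₀'H B₂' BG BR cL : ℝ} (hB₀'H : 0 < B₀'H) (hB₂' : 0 ≤ B₂')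
    (hBG : 0 ≤ BG) (hBR : 0 ≤ BR) (hcL : 0 < cL)
    (SLetC : ∀ i : {i : ZdIdx d L // ∃ (a : Site d) (M ρ : ℕ), L ≤ ρ ∧ ρ ≤ M ∧ 11 * d < M ∧ L ≤ d * M ∧
          i.Ω = cubeFam false L a M ρ i.k ∧ i.Λs = cubeLamS L a M ρ i.k ∧ i.Λb = cubeLamB L a M ρ i.k},
      SockLettersRD (𝔸 := 𝔸) L BG BR B₀'H B₂' cL i.1.η i.1.k i.1.Ω i.1.Λs) :
    ∀ B₀ Bbd cP9 : ℝ, 0 < B₀ → 0 ≤ Bbd → 0 < cP9 →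
      (∀ (j : {i : ZdIdx d L // ∃ (a : Site d) (M ρ : ℕ), L ≤ ρ ∧ ρ ≤ M ∧ 11 * d < M ∧ L ≤ d * M ∧
          i.Ω = cubeFam false L a M ρ i.k ∧ i.Λs = cubeLamS L a M ρ i.k ∧ i.Λb = cubeLamB L a M ρ i.k}) (m : ℕ), m ≤ j.1.k →
          SockB9P3D4β (𝔸 := 𝔸) L B₀ Bbd cP9 j.1.η m j.1.Ω j.1.Λs j.1.Λb) →
      ∃ B₀'c cP : ℝ, 0 < B₀'c ∧ 0 < cP ∧
      (∀ i : {i : ZdIdx d L // ∃ (a : Site d) (M ρ : ℕ), L ≤ ρ ∧ ρ ≤ M ∧ 11 * d < M ∧ L ≤ d * M ∧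
          i.Ω = cubeFam false L a M ρ i.k ∧ i.Λs = cubeLamS L a M ρ i.k ∧ i.Λb = cubeLamB L a M ρ i.k},
          SockP5base (𝔸 := 𝔸) L (max (max 1 B₀) (4 * Bbd / ((d : ℝ) * L - 1))) B₀'c cP i.1.η i.1.k i.1.Ω i.1.Λs) ∧
      (∀ i : {i : ZdIdx d L // ∃ (a : Site d) (M ρ : ℕ), L ≤ ρ ∧ ρ ≤ M ∧ 11 * d < M ∧ L ≤ d * M ∧
          i.Ω = cubeFam false L a M ρ i.k ∧ i.Λs = cubeLamS L a M ρ i.k ∧ i.Λb = cubeLamB L a M ρ i.k},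
          SockP5 (𝔸 := 𝔸) L (max (max 1 B₀) (4 * Bbd / ((d : ℝ) * L - 1))) B₀'c cP i.1.η i.1.k i.1.Ω i.1.Λs) := by
  intro B₀ Bbd cP9 hB₀ hBbd hcP9 hall
  have hL1 : 1 ≤ L := le_trans (by norm_num) hL
  have hd1 : 1 ≤ d := le_trans (by norm_num) hd2
  have hLr : (2 : ℝ) ≤ L := by exact_mod_cast hL
  have hdr : (2 : ℝ) ≤ d := by exact_mod_cast hd2
  have hdL : (0 : ℝ) < (d : ℝ) * L - 1 := by nlinarith [hLr, hdr]
  -- the ENLARGED constant (n05-e's): `B₀ ≤ B₀ˢ`, `1 ≤ B₀ˢ`, and the absorption window `4B_∂ ≤ (dL − 1)B₀ˢ` holds identically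
  set B₀S : ℝ := max (max 1 B₀) (4 * Bbd / ((d : ℝ) * L - 1)) with hB₀S_def
  have hB₀S1 : 1 ≤ B₀S := (le_max_left 1 B₀).trans (le_max_left _ _)
  have hB₀S : 0 < B₀S := lt_of_lt_of_le one_pos hB₀S1
  have hDS : B₀ ≤ B₀S := (le_max_right 1 B₀).trans (le_max_left _ _)
  have hB : 2 ≤ 5 * (d : ℝ) * L * B₀S := by
    have h1 : (2 : ℝ) ≤ 5 * (d : ℝ) * L := by nlinarith [hLr, hdr]
    nlinarith [h1, hB₀S1]
  have hBd : 4 * Bbd ≤ ((d : ℝ) * L - 1) * B₀S := by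
    have h1 : 4 * Bbd / ((d : ℝ) * L - 1) ≤ B₀S := le_max_right _ _
    have h2 : 4 * Bbd = ((d : ℝ) * L - 1) * (4 * Bbd / ((d : ℝ) * L - 1)) := by field_simp
    rw [h2]
    exact mul_le_mul_of_nonneg_left h1 hdL.le
  -- the output constant absorbs the free-constant condition of the provider
  set B₀'c : ℝ := max 1 (3 * (2 * (d : ℝ) * (L : ℝ) ^ 2) * BG * BR) with hB₀'c_def
  have hB₀'c : 0 < B₀'c := lt_of_lt_of_le one_pos (le_max_left _ _)
  have hfree : 3 * (2 * (d : ℝ) * (L : ℝ) ^ 2) * BG * BR ≤ B₀'c := le_max_right _ _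
  -- ONE threshold for the fixed-point sockets on the whole family, and the adapters' window
  obtain ⟨cF, hcF, H⟩ := exists_threshold_sockHFP_pair_bdryβ (𝔸 := 𝔸) hd2 hL hB₀S hB₀'c hB hB₀'H hB₂' hBG hBR hcP9 hcL hfree hBbd hBd
  obtain ⟨c₁, hc₁, hwin⟩ := windows4 hd1 hL1 hB₀S hB₀'c hB
  have hwin' : ∀ α₀ α₁ : ℝ, 0 < α₀ → 0 < α₁ → α₀ + α₁ ≤ min cF c₁ →
      8 * B₀'c * (5 * (d : ℝ) * L * B₀S) * (α₀ + α₁) ≤ 1 / 84 ∧ L * (5 * (d : ℝ) * L * B₀S * (α₀ + α₁)) ≤ 1 / 12 ∧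
        α₁ ≤ 1 / 4 ∧ 2 * α₁ ≤ 5 * (d : ℝ) * L * B₀S * (α₀ + α₁) :=
    fun α₀ α₁ hα₀ hα₁ hs => hwin α₀ α₁ hα₀ hα₁ (hs.trans (min_le_right _ _))
  -- at each cube member: the six laws and the boundary-layer law are theorems, the β family is moved to the enlarged constant
  have key : ∀ (i : {i : ZdIdx d L // ∃ (a : Site d) (M ρ : ℕ), L ≤ ρ ∧ ρ ≤ M ∧ 11 * d < M ∧ L ≤ d * M ∧
          i.Ω = cubeFam false L a M ρ i.k ∧ i.Λs = cubeLamS L a M ρ i.k ∧ i.Λb = cubeLamB L a M ρ i.k}) (a : Site d) (M ρ : ℕ), L ≤ ρ →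
      i.1.Ω = cubeFam false L a M ρ i.1.k → i.1.Λs = cubeLamS L a M ρ i.1.k → i.1.Λb = cubeLamB L a M ρ i.1.k →
      SockHFP₀ (𝔸 := 𝔸) L B₀S B₀'c cF i.1.η i.1.k (cubeFam false L a M ρ i.1.k) (cubeLamS L a M ρ i.1.k) ∧
        SockHFP (𝔸 := 𝔸) L B₀S B₀'c cF i.1.η i.1.k (cubeFam false L a M ρ i.1.k) (cubeLamS L a M ρ i.1.k) := by
    intro i a M ρ hρ hΩ hΛs hΛb
    have SLet' := SLetC i
    rw [hΩ, hΛs] at SLet'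
    have hall' : ∀ m, m ≤ i.1.k → SockB9P3D4β (𝔸 := 𝔸) L B₀S Bbd cP9 i.1.η m (cubeFam false L a M ρ i.1.k) (cubeLamS L a M ρ i.1.k)
        (cubeLamB L a M ρ i.1.k) := by
      intro m hm
      have h := hall i m hm
      rw [hΩ, hΛs, hΛb] at h
      exact sockB9P3D4β_mono_B₀ hDS i.1.hη.le h
    exact H i.1.hη i.1.hk (hΩ_cubeFam hL1 a M hρ i.1.k) (hbox_cubeLamB L a M ρ i.1.k) (hclass_cubeLamB L a M ρ i.1.k) (htw_cubeLamS hL1 a M ρ i.1.k)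
      (h8lt_cubeLamS L a M ρ i.1.k) (h8top_cubeLamS hL1 a M ρ i.1.k) (bdryLayer_cubeMember hL a M ρ i.1.k hρ i.1.hk) SLet' hall'
  refine ⟨B₀'c, min cF c₁, hB₀'c, lt_min hcF hc₁, fun i => ?_, fun i => ?_⟩
  · obtain ⟨a, M, ρ, hρ, -, -, -, hΩ, hΛs, hΛb⟩ := i.2
    rw [hΩ, hΛs]
    exact sockP5base_of_sockHFP₀ hd2 i.1.hη hL1 hB₀S.le (min_le_left _ _) hwin' (key i a M ρ hρ hΩ hΛs hΛb).1
  · obtain ⟨a, M, ρ, hρ, -, -, -, hΩ, hΛs, hΛb⟩ := i.2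
    rw [hΩ, hΛs]
    exact sockP5_of_sockHFP hd2 i.1.hη hL1 hB₀S.le (min_le_left _ _) hwin' (key i a M ρ hρ hΩ hΛs hΛb).2

end CubeSubfamily

#print axioms sockHFP_of_sockLettersRD_bdryβ
#print axioms exists_threshold_sockHFP_pair_bdryβ
#print axioms sockHFP_pair_cubeMember_bdryβ
#print axioms sp5_pair_cubeSubfamily_of_lettersRD_bdryβ

end Literature.MathematicalPhysics.QuantumFieldTheory.Balaban1983to89.B8SockHFPRDBdryBeta

end
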